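import Mathlib

/-!
# Crux `ShortCondensation` (stmt-MatrixMultiplication-15936) — level coverage lower bound (negative direction)

In every valid octahedral derivation of `J(n+m', n)` (all step types, any auxiliary width `m' ≥ n`)
that lists the determinant target `{n ≤ x < 2n}`, for every level `h` with `2 ≤ h < n` the listed sets
of level exactly `h` (level = number of elements `≥ n`) number at least `n²/h²`: their row × X-column
rectangles cover `[n] × [n]`.  Registered stub `stub_levelCoverage`; prove verbatim.

Combinatorial model: points are subsets `S` of `Fin (n + m')` (maximal minors of the `n × (n + m')`
matrix `[I_n | Z]`); the *level* of `S` is `#(S.filter (n ≤ ·.val))` (the size of the corresponding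
minor of `Z`); the *ball* is `{J : J.card = n ∧ level J ≤ 1}` (entries of `Z` and the empty minor).
A listing `f : Fin l → Finset _` is *valid* if each `f i` has `p ≠ q ∈ f i` and `u ≠ v ∉ f i` whose
five octahedron mates are each in the ball or listed earlier.  `S` *contains the entry* `(r, c)`
(`r c : Fin n`) iff `r ∉ S` and `n + c ∈ S`.

Proof outline:
* `levelCoverage_card`: every listed set has `n` elements (induction along the first mate);
* `levelCoverage_filter_card_le_exchange`: one exchange lowers the level by at most one;
* `levelCoverage_chain`: if `f i` contains the entry `(r, c)` then for every `2 ≤ h ≤ level (f i)`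
  some `f j`, `j ≤ i`, of level exactly `h` contains `(r, c)` (walk down along suitable mates:
  a mate of level `≥ 2` is not in the ball, hence listed earlier);
* counting: the target contains every entry, a level-`h` listed set contains at most `h · h`
  entries (`≤ h` missing rows since it has `n` elements of which `h` are `≥ n`, `≤ h` columns `≥ n`),
  so there are at least `n² / h²` listed sets of level `h`.
-/

set_option linter.dupNamespace false

namespace Summit.MatrixMultiplication.MatrixMultiplication.Theorems.ShortCondensation

/-- One exchange `S ↦ insert y (S.erase x)` lowers the number of elements satisfying a predicate
`P` by at most one. [folklore] -/
theorem levelCoverage_filter_card_le_exchange {α : Type*} [DecidableEq α] (P : α → Prop)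
    [DecidablePred P] (S : Finset α) (x y : α) :
    (S.filter P).card ≤ ((insert y (S.erase x)).filter P).card + 1 :=
  calc (S.filter P).card ≤ (insert x ((insert y (S.erase x)).filter P)).card := by
        apply Finset.card_le_card
        intro z hz
        rw [Finset.mem_filter] at hz
        rw [Finset.mem_insert]
        by_cases hzx : z = x
        · exact Or.inl hzx
        · right
          rw [Finset.mem_filter, Finset.mem_insert, Finset.mem_erase]
          exact ⟨Or.inr ⟨hzx, hz.1⟩, hz.2⟩
    _ ≤ ((insert y (S.erase x)).filter P).card + 1 := Finset.card_insert_le _ _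

/-- An exchange `S ↦ insert y (S.erase x)` with `x ∈ S`, `y ∉ S` preserves the cardinality.
[folklore] -/
theorem levelCoverage_card_exchange {α : Type*} [DecidableEq α] (S : Finset α) {x y : α}
    (hx : x ∈ S) (hy : y ∉ S) : (insert y (S.erase x)).card = S.card := by
  rw [Finset.card_insert_of_notMem (fun h => hy (Finset.mem_of_mem_erase h)),
    Finset.card_erase_of_mem hx]
  have := Finset.card_pos.mpr ⟨x, hx⟩
  omega

/-- In a valid listing every listed set has exactly `n` elements: the first mate
`insert u ((f i).erase p)` has the same cardinality as `f i` and is either in the ball (cardinality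
`n`) or listed earlier (induction). [folklore] -/
theorem levelCoverage_card {n m' l : ℕ} {f : Fin l → Finset (Fin (n + m'))}
    (hvalid : ∀ i : Fin l, ∃ p ∈ f i, ∃ q ∈ f i, p ≠ q ∧ ∃ u ∉ f i, ∃ v ∉ f i, u ≠ v ∧
      ∀ J ∈ [insert u ((f i).erase p), insert v ((f i).erase p), insert u ((f i).erase q),
        insert v ((f i).erase q), insert u (insert v (((f i).erase p).erase q))],
        (J.card = n ∧ (J.filter fun x : Fin (n + m') => n ≤ x.val).card ≤ 1) ∨
          ∃ j : Fin l, j < i ∧ f j = J)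
    (i : Fin l) : (f i).card = n := by
  suffices H : ∀ k : ℕ, ∀ i : Fin l, i.val < k → (f i).card = n from H _ i (Nat.lt_succ_self _)
  intro k
  induction k with
  | zero => intro i hi; exact absurd hi (Nat.not_lt_zero _)
  | succ k ih =>
    intro i hi
    obtain ⟨p, hp, q, -, -, u, hu, v, -, -, hall⟩ := hvalid i
    have hc : (insert u ((f i).erase p)).card = (f i).card := levelCoverage_card_exchange _ hp hu
    rcases hall (insert u ((f i).erase p)) (by simp) with ⟨hcard, -⟩ | ⟨j, hj, hfj⟩
    · omega
    · have hjk : j.val < k := by rw [Fin.lt_def] at hj; omega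
      have := ih j hjk
      rw [hfj] at this
      omega

/-- **Level-coverage chains.**  In a valid listing, if `f i` misses `rr` and contains `cc` then for
every `h` with `2 ≤ h ≤ level (f i)` some listed `f j` with `j ≤ i` of level exactly `h` misses `rr`
and contains `cc`: if `h < level (f i)`, pick `x ∈ {p, q}` different from `cc` and `y ∈ {u, v}`
different from `rr`; the mate `insert y ((f i).erase x)` misses `rr`, contains `cc`, has level
`≥ level (f i) - 1 ≥ h ≥ 2`, so it is not in the ball and hence is listed earlier; induct.
[folklore] -/
theorem levelCoverage_chain {n m' l : ℕ} {f : Fin l → Finset (Fin (n + m'))}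
    (hvalid : ∀ i : Fin l, ∃ p ∈ f i, ∃ q ∈ f i, p ≠ q ∧ ∃ u ∉ f i, ∃ v ∉ f i, u ≠ v ∧
      ∀ J ∈ [insert u ((f i).erase p), insert v ((f i).erase p), insert u ((f i).erase q),
        insert v ((f i).erase q), insert u (insert v (((f i).erase p).erase q))],
        (J.card = n ∧ (J.filter fun x : Fin (n + m') => n ≤ x.val).card ≤ 1) ∨
          ∃ j : Fin l, j < i ∧ f j = J)
    (i : Fin l) (rr cc : Fin (n + m')) (hrr : rr ∉ f i) (hcc : cc ∈ f i) (h : ℕ) (h2 : 2 ≤ h)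
    (hle : h ≤ ((f i).filter fun x : Fin (n + m') => n ≤ x.val).card) :
    ∃ j : Fin l, j ≤ i ∧ ((f j).filter fun x : Fin (n + m') => n ≤ x.val).card = h ∧
      rr ∉ f j ∧ cc ∈ f j := by
  suffices H : ∀ k : ℕ, ∀ i : Fin l, i.val < k → rr ∉ f i → cc ∈ f i →
      h ≤ ((f i).filter fun x : Fin (n + m') => n ≤ x.val).card →
      ∃ j : Fin l, j ≤ i ∧ ((f j).filter fun x : Fin (n + m') => n ≤ x.val).card = h ∧
        rr ∉ f j ∧ cc ∈ f j from H _ i (Nat.lt_succ_self _) hrr hcc hle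
  intro k
  induction k with
  | zero => intro i hi; exact absurd hi (Nat.not_lt_zero _)
  | succ k ih =>
    intro i hi hrr hcc hle
    by_cases heq : ((f i).filter fun x : Fin (n + m') => n ≤ x.val).card = h
    · exact ⟨i, le_rfl, heq, hrr, hcc⟩
    have hlt : h < ((f i).filter fun x : Fin (n + m') => n ≤ x.val).card :=
      lt_of_le_of_ne hle (Ne.symm heq)
    obtain ⟨p, hp, q, hq, hpq, u, hu, v, hv, huv, hall⟩ := hvalid i
    -- the generic descent step along a mate `insert y ((f i).erase x)` with `x ≠ cc`, `y ≠ rr`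
    have step : ∀ x y : Fin (n + m'), x ∈ f i → x ≠ cc → y ∉ f i → y ≠ rr →
        (((insert y ((f i).erase x)).card = n ∧
            ((insert y ((f i).erase x)).filter fun x : Fin (n + m') => n ≤ x.val).card ≤ 1) ∨
          ∃ j : Fin l, j < i ∧ f j = insert y ((f i).erase x)) →
        ∃ j : Fin l, j ≤ i ∧ ((f j).filter fun x : Fin (n + m') => n ≤ x.val).card = h ∧
          rr ∉ f j ∧ cc ∈ f j := by
      intro x y _hx hxcc _hy hyrr hM
      have hlev := levelCoverage_filter_card_le_exchange (fun z : Fin (n + m') => n ≤ z.val)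
        (f i) x y
      rcases hM with ⟨-, hball⟩ | ⟨j', hj', hfj'⟩
      · omega
      · have hrrM : rr ∉ f j' := by
          rw [hfj', Finset.mem_insert, Finset.mem_erase]
          rintro (e | ⟨-, e⟩)
          · exact hyrr e.symm
          · exact hrr e
        have hccM : cc ∈ f j' := by
          rw [hfj', Finset.mem_insert, Finset.mem_erase]
          exact Or.inr ⟨fun e => hxcc e.symm, hcc⟩
        have hleM : h ≤ ((f j').filter fun x : Fin (n + m') => n ≤ x.val).card := by
          rw [hfj']
          omega
        have hj'k : j'.val < k := by rw [Fin.lt_def] at hj'; omega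
        obtain ⟨j, hjle, hlevj, hrrj, hccj⟩ := ih j' hj'k hrrM hccM hleM
        exact ⟨j, hjle.trans hj'.le, hlevj, hrrj, hccj⟩
    by_cases hpc : p = cc
    · by_cases hur : u = rr
      · exact step q v hq (fun e => hpq (hpc.trans e.symm)) hv (fun e => huv (hur.trans e.symm))
          (hall _ (by simp))
      · exact step q u hq (fun e => hpq (hpc.trans e.symm)) hu hur (hall _ (by simp))
    · by_cases hur : u = rr
      · exact step p v hp hpc hv (fun e => huv (hur.trans e.symm)) (hall _ (by simp))
      · exact step p u hp hpc hu hur (hall _ (by simp))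

/-- Column count: the columns `c : Fin n` with `n + c ∈ S` inject (via `c ↦ n + c`) into the
elements of `S` that are `≥ n`, so there are at most `level S` of them. [folklore] -/
theorem levelCoverage_cols_card_le {n m' : ℕ} (hnm : n ≤ m') (S : Finset (Fin (n + m'))) :
    (Finset.univ.filter fun c : Fin n => Fin.natAdd n (Fin.castLE hnm c) ∈ S).card ≤
      (S.filter fun x : Fin (n + m') => n ≤ x.val).card := by
  have hinj : Function.Injective fun c : Fin n => Fin.natAdd n (Fin.castLE hnm c) := by
    intro a b hab
    have := congrArg Fin.val hab
    simp only [Fin.val_natAdd, Fin.val_castLE] at this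
    exact Fin.ext (by omega)
  rw [← Finset.card_image_of_injective
    (Finset.univ.filter fun c : Fin n => Fin.natAdd n (Fin.castLE hnm c) ∈ S) hinj]
  apply Finset.card_le_card
  intro x hx
  rw [Finset.mem_image] at hx
  obtain ⟨c, hc, rfl⟩ := hx
  rw [Finset.mem_filter] at hc ⊢
  refine ⟨hc.2, ?_⟩
  simp only [Fin.val_natAdd, Fin.val_castLE]
  omega

/-- Row count: if `S ⊆ Fin (n + m')` has exactly `n` elements, the rows `r : Fin n` with `r ∉ S`
number at most `level S`: the elements of `S` below `n` are images of rows in `S` under the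
injection `r ↦ r`, so at least `n - level S` rows lie in `S`. [folklore] -/
theorem levelCoverage_rows_card_le {n m' : ℕ} (S : Finset (Fin (n + m'))) (hS : S.card = n) :
    (Finset.univ.filter fun r : Fin n => Fin.castAdd m' r ∉ S).card ≤
      (S.filter fun x : Fin (n + m') => n ≤ x.val).card := by
  have h1 : (Finset.univ.filter fun r : Fin n => Fin.castAdd m' r ∈ S).card +
      (Finset.univ.filter fun r : Fin n => Fin.castAdd m' r ∉ S).card = n := by
    rw [Finset.card_filter_add_card_filter_not, Finset.card_univ, Fintype.card_fin]
  have h2 : (S.filter fun x : Fin (n + m') => n ≤ x.val).card +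
      (S.filter fun x : Fin (n + m') => ¬ n ≤ x.val).card = n := by
    rw [Finset.card_filter_add_card_filter_not, hS]
  have hinj : Function.Injective fun r : Fin n => Fin.castAdd m' r := by
    intro a b hab
    have := congrArg Fin.val hab
    simp only [Fin.val_castAdd] at this
    exact Fin.ext this
  have h3 : (S.filter fun x : Fin (n + m') => ¬ n ≤ x.val).card ≤
      (Finset.univ.filter fun r : Fin n => Fin.castAdd m' r ∈ S).card := by
    rw [← Finset.card_image_of_injective
      (Finset.univ.filter fun r : Fin n => Fin.castAdd m' r ∈ S) hinj]
    apply Finset.card_le_card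
    intro x hx
    rw [Finset.mem_filter] at hx
    rw [Finset.mem_image]
    have hxn : x.val < n := by omega
    have hxe : Fin.castAdd m' (⟨x.val, hxn⟩ : Fin n) = x := Fin.ext (by simp)
    refine ⟨⟨x.val, hxn⟩, ?_, hxe⟩
    rw [Finset.mem_filter, hxe]
    exact ⟨Finset.mem_univ _, hx.1⟩
  omega

/-- **Level coverage lower bound (negative direction toward `¬ ShortCondensation`).**  In every
valid octahedral listing of subsets of `Fin (n + m')` (`n ≤ m'`; each listed set has `p ≠ q` inside
and `u ≠ v` outside whose five octahedron mates are in the ball `{#J = n, level J ≤ 1}` or listed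
earlier) that lists the determinant target `{n ≤ x < 2n}`, for every level `h` with `2 ≤ h < n`
there are at least `n² / h²` listed sets of level exactly `h` (level `= #{x ∈ S | n ≤ x}`): by the
level-coverage chains every entry `(r, c) ∈ [n] × [n]` (row `r` missing, column `n + c` present) of
the target is contained in some listed set of level `h`, and a listed set of level `h` has `n`
elements, hence misses at most `h` rows and contains at most `h` columns `≥ n`, so it contains at
most `h · h` entries. [folklore] -/
theorem stub_levelCoverage :
    ∀ (n m' : ℕ), n ≤ m' → ∀ (l : ℕ) (f : Fin l → Finset (Fin (n + m'))), (∀ i : Fin l, ∃ p ∈ f i, ∃ q ∈ f i, p ≠ q ∧ ∃ u ∉ f i, ∃ v ∉ f i, u ≠ v ∧ ∀ J ∈ [insert u ((f i).erase p), insert v ((f i).erase p), insert u ((f i).erase q), insert v ((f i).erase q), insert u (insert v (((f i).erase p).erase q))], (J.card = n ∧ (J.filter fun x : Fin (n + m') => n ≤ x.val).card ≤ 1) ∨ ∃ j : Fin l, j < i ∧ f j = J) → (∃ i : Fin l, f i = Finset.univ.filter fun x : Fin (n + m') => n ≤ x.val ∧ x.val < 2 * n) → ∀ h : ℕ, 2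 ≤ h → h < n → n * n ≤ h * h * (Finset.univ.filter fun i : Fin l => ((f i).filter fun x : Fin (n + m') => n ≤ x.val).card = h).card := by
  intro n m' hnm l f hvalid htarget h h2 hhn
  obtain ⟨i₀, hi₀⟩ := htarget
  -- the target has level `n`
  have hTfil : ((f i₀).filter fun x : Fin (n + m') => n ≤ x.val) = f i₀ := by
    apply Finset.filter_true_of_mem
    intro x hx
    rw [hi₀, Finset.mem_filter] at hx
    exact hx.2.1
  have hTlev : ((f i₀).filter fun x : Fin (n + m') => n ≤ x.val).card = n := by
    rw [hTfil, levelCoverage_card hvalid i₀]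
  -- every entry `(r, c)` of the target is contained in a listed set of level `h`
  have key : ∀ rc : Fin n × Fin n, ∃ j : Fin l,
      ((f j).filter fun x : Fin (n + m') => n ≤ x.val).card = h ∧
        Fin.castAdd m' rc.1 ∉ f j ∧ Fin.natAdd n (Fin.castLE hnm rc.2) ∈ f j := by
    intro rc
    have hrr : Fin.castAdd m' rc.1 ∉ f i₀ := by
      rw [hi₀, Finset.mem_filter]
      rintro ⟨-, h1, -⟩
      simp only [Fin.val_castAdd] at h1
      omega
    have hcc : Fin.natAdd n (Fin.castLE hnm rc.2) ∈ f i₀ := by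
      rw [hi₀, Finset.mem_filter]
      refine ⟨Finset.mem_univ _, ?_⟩
      simp only [Fin.val_natAdd, Fin.val_castLE]
      omega
    obtain ⟨j, -, hj⟩ := levelCoverage_chain hvalid i₀ _ _ hrr hcc h h2 (by rw [hTlev]; omega)
    exact ⟨j, hj⟩
  choose g hg using key
  have hmaps : ∀ rc ∈ (Finset.univ : Finset (Fin n × Fin n)), g rc ∈
      (Finset.univ.filter fun i : Fin l =>
        ((f i).filter fun x : Fin (n + m') => n ≤ x.val).card = h) := by
    intro rc _
    rw [Finset.mem_filter]
    exact ⟨Finset.mem_univ _, (hg rc).1⟩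
  -- each fibre lies in a `rows × cols` rectangle of size at most `h · h`
  have hfib : ∀ j ∈ (Finset.univ.filter fun i : Fin l =>
        ((f i).filter fun x : Fin (n + m') => n ≤ x.val).card = h),
      (Finset.univ.filter fun rc : Fin n × Fin n => g rc = j).card ≤ h * h := by
    intro j hj
    rw [Finset.mem_filter] at hj
    have hcardj : (f j).card = n := levelCoverage_card hvalid j
    have hrows := levelCoverage_rows_card_le (f j) hcardj
    have hcols := levelCoverage_cols_card_le hnm (f j)
    rw [hj.2] at hrows hcols
    calc (Finset.univ.filter fun rc : Fin n × Fin n => g rc = j).card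
        ≤ ((Finset.univ.filter fun r : Fin n => Fin.castAdd m' r ∉ f j) ×ˢ
            (Finset.univ.filter fun c : Fin n => Fin.natAdd n (Fin.castLE hnm c) ∈ f j)).card := by
          apply Finset.card_le_card
          intro rc hrc
          rw [Finset.mem_filter] at hrc
          rw [Finset.mem_product, Finset.mem_filter, Finset.mem_filter]
          have hgrc := hg rc
          rw [hrc.2] at hgrc
          exact ⟨⟨Finset.mem_univ _, hgrc.2.1⟩, ⟨Finset.mem_univ _, hgrc.2.2⟩⟩
      _ = (Finset.univ.filter fun r : Fin n => Fin.castAdd m' r ∉ f j).card *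
            (Finset.univ.filter fun c : Fin n => Fin.natAdd n (Fin.castLE hnm c) ∈ f j).card :=
          Finset.card_product _ _
      _ ≤ h * h := Nat.mul_le_mul hrows hcols
  have H := Finset.card_le_mul_card_image_of_maps_to hmaps (h * h) hfib
  rw [Finset.card_univ, Fintype.card_prod, Fintype.card_fin] at H
  exact H

/-- **Summed form of the level coverage bound.**  Under the same hypotheses, for every level `h`
with `2 ≤ h < n` the listing has length `l ≥ n² / h²`. [folklore] -/
theorem levelCoverage_length_bound :
    ∀ (n m' : ℕ), n ≤ m' → ∀ (l : ℕ) (f : Fin l → Finset (Fin (n + m'))), (∀ i : Fin l, ∃ p ∈ f i, ∃ q ∈ f i, p ≠ q ∧ ∃ u ∉ f i, ∃ v ∉ f i, u ≠ v ∧ ∀ J ∈ [insert u ((f i).erase p), insert v ((f i).erase p), insert u ((f i).erase q), insert v ((f i).erase q), insert u (insert v (((f i).erase p).erase q))], (J.card = n ∧ (J.filter fun x : Fin (n + m') => n ≤ x.val).card ≤ 1) ∨ ∃ j : Fin l, j < i ∧ f j = J) → (∃ i : Fin l, f i = Finset.univ.filter fun x : Fin (n + m') => n ≤ x.val ∧ x.val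 < 2 * n) → ∀ h : ℕ, 2 ≤ h → h < n → n * n ≤ h * h * l := by
  intro n m' hnm l f hvalid htarget h h2 hhn
  calc n * n ≤ h * h * (Finset.univ.filter fun i : Fin l =>
          ((f i).filter fun x : Fin (n + m') => n ≤ x.val).card = h).card :=
        stub_levelCoverage n m' hnm l f hvalid htarget h h2 hhn
    _ ≤ h * h * l := by
        apply Nat.mul_le_mul_left
        calc (Finset.univ.filter fun i : Fin l =>
                ((f i).filter fun x : Fin (n + m') => n ≤ x.val).card = h).card
            ≤ (Finset.univ : Finset (Fin l)).card := Finset.card_filter_le _ _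
          _ = l := by rw [Finset.card_univ, Fintype.card_fin]

end Summit.MatrixMultiplication.MatrixMultiplication.Theorems.ShortCondensation
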